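import Mathlib
import Summits.QuantumFields.YangMills.Theorems.TransportFieldSu2ColourAlgebra
import Summits.QuantumFields.YangMills.Theorems.FemtoTransferGapSlabFlowLift
import Literature.MathematicalPhysics.QuantumLattice.IsolatingTwistIffGenerating
import HarnessLib

/-!
# Transport-field regularity kit, tranche 4b: the smoothed colour-electric field `B = T_U^{[n]}M₀(U)` is `𝔰𝔲(2)`-valued, gauge-COVARIANT
# and centre-twist INVARIANT

For the `IsPhys (XΩ)` clause of `CovariantCurrentDoor.CurrentStatePhysical` ⟨stmt-QuantumFields-23381⟩.  With the item's objects — the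
direction-`1` Polyakov holonomy `P₁(s)`, the seed `M₀(U)_s = Re tr P₁(s) · ½(P₁(s) − P₁(s)⁻¹)`, the covariant smoothing
`(T_U m)_s = ⅕(m_s + Σ_{i=1,2}(U_{s,i} m_{s+î} U_{s,i}⁻¹ + U_{s−î,i}⁻¹ m_{s−î} U_{s−î,i}))` and `B = T_U^{[n]}M₀(U)`:
* `smoothStep_su2`, `smoothedField_su2` — every `B(U)_s` is skew-Hermitian and traceless;
* `seed_gaugeTransform`, `smoothStep_gaugeTransform`, ★ `smoothedField_gaugeTransform` — `B(U^g)_s = g_s B(U)_s g_s⁻¹`;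
* `coe_center_su2` (a central element of `SU(2)` is `±1`), `seed_twist`, `smoothStep_twist`, ★ `smoothedField_twist` — `B(twist_k^z U) = B(U)`.
HONEST FRAMING: lattice bookkeeping; no claim about the cruxes, K2a or the YM mass gap.  No `sorry`, no new axiom, no new definition.
References: [cite: Balaban1985UV3, p. 260]; [cite: tHooft1979Flux, §2 (2.2)]; [cite: Luscher1983, §2].
-/

set_option autoImplicit false

noncomputable section

open scoped BigOperators
open Literature.MathematicalPhysics.QuantumFieldTheory (GaugeConfig Site Edge gaugeTransform)
open Literature.MathematicalPhysics.QuantumLattice (mem_center_specialUnitaryGroup_iff suCenter centerPhase)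

namespace Summit.QuantumFields.YangMills.Theorems.TransportField

open Summit.QuantumFields.YangMills.Theorems.FemtoTransferGap

variable {L : ℕ}

/-! ## §1 `B` is `𝔰𝔲(2)`-valued -/

/-- One smoothing step preserves `𝔰𝔲(2)`-valuedness. [folklore] -/
theorem smoothStep_su2 (U : GaugeConfig 3 L SU2) {m : Site 3 L → Matrix (Fin 2) (Fin 2) ℂ}
    (hm : ∀ s, (m s).conjTranspose = -m s ∧ (m s).trace = 0) (s : Site 3 L) :
    (((1 / 5 : ℂ) • (m s + ∑ i ∈ ({1, 2} : Finset (Fin 3)),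
        (su2Rep (U (s, i)) * m ((s).shift i) * su2Rep (U (s, i))⁻¹ +
          su2Rep (U (s - Pi.single i 1, i))⁻¹ * m (s - Pi.single i 1) * su2Rep (U (s - Pi.single i 1, i)))))).conjTranspose = -((1 / 5 : ℂ) • (m s + ∑ i ∈ ({1, 2} : Finset (Fin 3)),
        (su2Rep (U (s, i)) * m ((s).shift i) * su2Rep (U (s, i))⁻¹ +
          su2Rep (U (s - Pi.single i 1, i))⁻¹ * m (s - Pi.single i 1) * su2Rep (U (s - Pi.single i 1, i))))) ∧
    (((1 / 5 : ℂ) • (m s + ∑ i ∈ ({1, 2} : Finset (Fin 3)),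
        (su2Rep (U (s, i)) * m ((s).shift i) * su2Rep (U (s, i))⁻¹ +
          su2Rep (U (s - Pi.single i 1, i))⁻¹ * m (s - Pi.single i 1) * su2Rep (U (s - Pi.single i 1, i)))))).trace = 0 := by
  constructor
  · have h5 : star (1 / 5 : ℂ) = 1 / 5 := by rw [Complex.star_def, map_div₀, map_one, map_ofNat]
    rw [Matrix.conjTranspose_smul, h5, ← smul_neg]
    congr 1
    rw [Matrix.conjTranspose_add, Matrix.conjTranspose_sum, neg_add, ← Finset.sum_neg_distrib, (hm s).1]
    congr 1
    refine Finset.sum_congr rfl fun i _ => ?_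
    rw [Matrix.conjTranspose_add, conjTranspose_conj_su2 _ (hm _).1, conjTranspose_conj_su2' _ (hm _).1, neg_add]
  · rw [Matrix.trace_smul, Matrix.trace_add, Matrix.trace_sum, (hm s).2]
    simp only [Matrix.trace_add, trace_conj_su2, trace_conj_su2', (hm _).2, add_zero, Finset.sum_const_zero, smul_zero]

/-- The seed `M₀(U)_s` is `𝔰𝔲(2)`-valued. [folklore] -/
theorem seed_su2 (U : GaugeConfig 3 L SU2) (s : Site 3 L) :
    ((((su2Rep (polyakovSite s U ((0 : Site 3 1), (1 : Fin 3)))).trace.re : ℂ) • ((1 / 2 : ℂ) • (su2Rep (polyakovSite s U ((0 : Site 3 1), (1 : Fin 3))) - su2Rep (polyakovSite s U ((0 : Site 3 1), (1 : Fin 3)))⁻¹)))).conjTranspose = -(((su2Rep (polyakovSite s U ((0 : Site 3 1), (1 : Fin 3)))).trace.re : ℂ) • ((1 / 2 : ℂ) • (su2Rep (polyakovSite s U ((0 : Site 3 1), (1 : Fin 3))) - su2Rep (polyakovSite s U ((0 : Site 3 1), (1 : Fin 3)))⁻¹))) ∧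
    ((((su2Rep (polyakovSite s U ((0 : Site 3 1), (1 : Fin 3)))).trace.re : ℂ) • ((1 / 2 : ℂ) • (su2Rep (polyakovSite s U ((0 : Site 3 1), (1 : Fin 3))) - su2Rep (polyakovSite s U ((0 : Site 3 1), (1 : Fin 3)))⁻¹)))).trace = 0 :=
  ⟨conjTranspose_seed_su2 _, trace_seed_su2 _⟩

/-- ★ **`B(U)_s ∈ 𝔰𝔲(2)`** for every `n`, `U`, `s`. [folklore] -/
theorem smoothedField_su2 [NeZero L] (n : ℕ) (U : GaugeConfig 3 L SU2) : ∀ s : Site 3 L,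
    ((((fun m : Site 3 L → Matrix (Fin 2) (Fin 2) ℂ => fun s : Site 3 L =>
        (1 / 5 : ℂ) • (m s + ∑ i ∈ ({1, 2} : Finset (Fin 3)),
          (su2Rep (U (s, i)) * m (s.shift i) * su2Rep (U (s, i))⁻¹ +
            su2Rep (U (s - Pi.single i 1, i))⁻¹ * m (s - Pi.single i 1) * su2Rep (U (s - Pi.single i 1, i))))))^[n] (fun s : Site 3 L => (((su2Rep (polyakovSite s U ((0 : Site 3 1), (1 : Fin 3)))).trace.re : ℂ) • ((1 / 2 : ℂ) • (su2Rep (polyakovSite s U ((0 : Site 3 1), (1 : Fin 3))) - su2Rep (polyakovSite s U ((0 : Site 3 1), (1 : Fin 3)))⁻¹))))) s).conjTranspose = -((((fun m : Site 3 L → Matrix (Fin 2) (Fin 2) ℂ => fun s : Site 3 L =>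
        (1 / 5 : ℂ) • (m s + ∑ i ∈ ({1, 2} : Finset (Fin 3)),
          (su2Rep (U (s, i)) * m (s.shift i) * su2Rep (U (s, i))⁻¹ +
            su2Rep (U (s - Pi.single i 1, i))⁻¹ * m (s - Pi.single i 1) * su2Rep (U (s - Pi.single i 1, i))))))^[n] (fun s : Site 3 L => (((su2Rep (polyakovSite s U ((0 : Site 3 1), (1 : Fin 3)))).trace.re : ℂ) • ((1 / 2 : ℂ) • (su2Rep (polyakovSite s U ((0 : Site 3 1), (1 : Fin 3))) - su2Rep (polyakovSite s U ((0 : Site 3 1), (1 : Fin 3)))⁻¹))))) s) ∧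
    ((((fun m : Site 3 L → Matrix (Fin 2) (Fin 2) ℂ => fun s : Site 3 L =>
        (1 / 5 : ℂ) • (m s + ∑ i ∈ ({1, 2} : Finset (Fin 3)),
          (su2Rep (U (s, i)) * m (s.shift i) * su2Rep (U (s, i))⁻¹ +
            su2Rep (U (s - Pi.single i 1, i))⁻¹ * m (s - Pi.single i 1) * su2Rep (U (s - Pi.single i 1, i))))))^[n] (fun s : Site 3 L => (((su2Rep (polyakovSite s U ((0 : Site 3 1), (1 : Fin 3)))).trace.re : ℂ) • ((1 / 2 : ℂ) • (su2Rep (polyakovSite s U ((0 : Site 3 1), (1 : Fin 3))) - su2Rep (polyakovSite s U ((0 : Site 3 1), (1 : Fin 3)))⁻¹))))) s).trace = 0 := by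
  induction n with
  | zero => intro s; simpa only [Function.iterate_zero, id_eq] using seed_su2 U s
  | succ n ih =>
    intro s
    rw [Function.iterate_succ_apply']
    exact smoothStep_su2 U ih s

/-! ## §2 `B` is gauge-covariant -/

/-- The direction-`1` Polyakov holonomy is conjugated at its base point. [cite: Luscher1983, §2] -/
theorem polyakovSite_one_gaugeTransform [NeZero L] (g : Site 3 L → SU2) (U : GaugeConfig 3 L SU2) (s : Site 3 L) :
    polyakovSite s (gaugeTransform g U) ((0 : Site 3 1), (1 : Fin 3)) = g s * polyakovSite s U ((0 : Site 3 1), (1 : Fin 3)) * (g s)⁻¹ := by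
  rw [polyakovSite_gaugeTransform]
  rfl

/-- The seed is gauge-covariant: `M₀(U^g)_s = g_s M₀(U)_s g_s⁻¹`. [folklore] -/
theorem seed_gaugeTransform [NeZero L] (g : Site 3 L → SU2) (U : GaugeConfig 3 L SU2) (s : Site 3 L) :
    (((su2Rep (polyakovSite s (gaugeTransform g U) ((0 : Site 3 1), (1 : Fin 3)))).trace.re : ℂ) • ((1 / 2 : ℂ) • (su2Rep (polyakovSite s (gaugeTransform g U) ((0 : Site 3 1), (1 : Fin 3))) - su2Rep (polyakovSite s (gaugeTransform g U) ((0 : Site 3 1), (1 : Fin 3)))⁻¹))) = su2Rep (g s) * (((su2Rep (polyakovSite s U ((0 : Site 3 1), (1 : Fin 3)))).trace.re : ℂ) • ((1 / 2 : ℂ) • (su2Rep (polyakovSite s U ((0 : Site 3 1), (1 : Fin 3))) - su2Rep (polyakovSite s U ((0 : Site 3 1), (1 : Fin 3)))⁻¹))) * su2Rep (g s)⁻¹ := by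
  rw [polyakovSite_one_gaugeTransform]
  rw [show (g s * polyakovSite s U ((0 : Site 3 1), (1 : Fin 3)) * (g s)⁻¹)⁻¹ = g s * (polyakovSite s U ((0 : Site 3 1), (1 : Fin 3)))⁻¹ * (g s)⁻¹ by group]
  rw [map_mul, map_mul, map_mul, map_mul, trace_conj_su2, Matrix.mul_smul, Matrix.smul_mul, Matrix.mul_smul, Matrix.smul_mul,
    Matrix.mul_sub, Matrix.sub_mul]

/-- One smoothing step is gauge-covariant: `T_{U^g}(g·m·g⁻¹)_s = g_s (T_U m)_s g_s⁻¹`. [folklore] -/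
theorem smoothStep_gaugeTransform (g : Site 3 L → SU2) (U : GaugeConfig 3 L SU2) (m : Site 3 L → Matrix (Fin 2) (Fin 2) ℂ) (s : Site 3 L) :
    ((1 / 5 : ℂ) • ((fun s => su2Rep (g s) * m s * su2Rep (g s)⁻¹) s + ∑ i ∈ ({1, 2} : Finset (Fin 3)),
        (su2Rep ((gaugeTransform g U) (s, i)) * (fun s => su2Rep (g s) * m s * su2Rep (g s)⁻¹) ((s).shift i) * su2Rep ((gaugeTransform g U) (s, i))⁻¹ +
          su2Rep ((gaugeTransform g U) (s - Pi.single i 1, i))⁻¹ * (fun s => su2Rep (g s) * m s * su2Rep (g s)⁻¹) (s - Pi.single i 1) * su2Rep ((gaugeTransform g U) (s - Pi.single i 1, i))))) =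
      su2Rep (g s) * ((1 / 5 : ℂ) • (m s + ∑ i ∈ ({1, 2} : Finset (Fin 3)),
        (su2Rep (U (s, i)) * m ((s).shift i) * su2Rep (U (s, i))⁻¹ +
          su2Rep (U (s - Pi.single i 1, i))⁻¹ * m (s - Pi.single i 1) * su2Rep (U (s - Pi.single i 1, i))))) * su2Rep (g s)⁻¹ := by
  have hfw : ∀ i : Fin 3, su2Rep (gaugeTransform g U (s, i)) * (su2Rep (g (s.shift i)) * m (s.shift i) * su2Rep (g (s.shift i))⁻¹) *
      su2Rep (gaugeTransform g U (s, i))⁻¹ = su2Rep (g s) * (su2Rep (U (s, i)) * m (s.shift i) * su2Rep (U (s, i))⁻¹) * su2Rep (g s)⁻¹ := by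
    intro i
    simp only [gaugeTransform, mul_inv_rev, inv_inv, map_mul, Matrix.mul_assoc]
    congr 2
    rw [← Matrix.mul_assoc (su2Rep (g (s.shift i))⁻¹), ← map_mul, inv_mul_cancel, map_one, Matrix.one_mul]
    congr 1
    rw [← Matrix.mul_assoc (su2Rep (g (s.shift i))⁻¹), ← map_mul, inv_mul_cancel, map_one, Matrix.one_mul]
  have hbw : ∀ i : Fin 3, su2Rep (gaugeTransform g U (s - Pi.single i 1, i))⁻¹ *
      (su2Rep (g (s - Pi.single i 1)) * m (s - Pi.single i 1) * su2Rep (g (s - Pi.single i 1))⁻¹) *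
        su2Rep (gaugeTransform g U (s - Pi.single i 1, i)) =
      su2Rep (g s) * (su2Rep (U (s - Pi.single i 1, i))⁻¹ * m (s - Pi.single i 1) * su2Rep (U (s - Pi.single i 1, i))) * su2Rep (g s)⁻¹ := by
    intro i
    have hs : (s - Pi.single i 1).shift i = s := by simp only [Site.shift, sub_add_cancel]
    simp only [gaugeTransform, hs, mul_inv_rev, inv_inv, map_mul, Matrix.mul_assoc]
    congr 2
    rw [← Matrix.mul_assoc (su2Rep (g (s - Pi.single i 1))⁻¹), ← map_mul, inv_mul_cancel, map_one, Matrix.one_mul]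
    congr 1
    rw [← Matrix.mul_assoc (su2Rep (g (s - Pi.single i 1))⁻¹), ← map_mul, inv_mul_cancel, map_one, Matrix.one_mul]
  simp only [hfw, hbw, ← Matrix.mul_add, ← Matrix.add_mul, ← Finset.mul_sum, ← Finset.sum_mul, Matrix.mul_smul, Matrix.smul_mul]

/-- ★ **`B(U^g)_s = g_s B(U)_s g_s⁻¹`.** [folklore] -/
theorem smoothedField_gaugeTransform [NeZero L] (n : ℕ) (g : Site 3 L → SU2) (U : GaugeConfig 3 L SU2) :
    (((fun m : Site 3 L → Matrix (Fin 2) (Fin 2) ℂ => fun s : Site 3 L =>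
        (1 / 5 : ℂ) • (m s + ∑ i ∈ ({1, 2} : Finset (Fin 3)),
          (su2Rep ((gaugeTransform g U) (s, i)) * m (s.shift i) * su2Rep ((gaugeTransform g U) (s, i))⁻¹ +
            su2Rep ((gaugeTransform g U) (s - Pi.single i 1, i))⁻¹ * m (s - Pi.single i 1) * su2Rep ((gaugeTransform g U) (s - Pi.single i 1, i))))))^[n] (fun s : Site 3 L => (((su2Rep (polyakovSite s (gaugeTransform g U) ((0 : Site 3 1), (1 : Fin 3)))).trace.re : ℂ) • ((1 / 2 : ℂ) • (su2Rep (polyakovSite s (gaugeTransform g U) ((0 : Site 3 1), (1 : Fin 3))) - su2Rep (polyakovSite s (gaugeTransform g U) ((0 : Site 3 1), (1 : Fin 3)))⁻¹))))) =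
      fun s : Site 3 L => su2Rep (g s) * (((fun m : Site 3 L → Matrix (Fin 2) (Fin 2) ℂ => fun s : Site 3 L =>
        (1 / 5 : ℂ) • (m s + ∑ i ∈ ({1, 2} : Finset (Fin 3)),
          (su2Rep (U (s, i)) * m (s.shift i) * su2Rep (U (s, i))⁻¹ +
            su2Rep (U (s - Pi.single i 1, i))⁻¹ * m (s - Pi.single i 1) * su2Rep (U (s - Pi.single i 1, i))))))^[n] (fun s : Site 3 L => (((su2Rep (polyakovSite s U ((0 : Site 3 1), (1 : Fin 3)))).trace.re : ℂ) • ((1 / 2 : ℂ) • (su2Rep (polyakovSite s U ((0 : Site 3 1), (1 : Fin 3))) - su2Rep (polyakovSite s U ((0 : Site 3 1), (1 : Fin 3)))⁻¹))))) s * su2Rep (g s)⁻¹ := by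
  induction n with
  | zero =>
    funext s
    simp only [Function.iterate_zero, id_eq]
    exact seed_gaugeTransform g U s
  | succ n ih =>
    rw [Function.iterate_succ_apply', Function.iterate_succ_apply', ih]
    funext s
    exact smoothStep_gaugeTransform g U _ s

/-! ## §3 `B` is invariant under centre twists -/

/-- A central element of `SU(2)` is `±1`. [cite: tHooft1979Flux, §2 (2.2)] -/
theorem coe_center_su2 {z : SU2} (hz : z ∈ Subgroup.center SU2) :
    ∃ c : ℂ, (c = 1 ∨ c = -1) ∧ su2Rep z = c • (1 : Matrix (Fin 2) (Fin 2) ℂ) := by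
  obtain ⟨k, hk⟩ := (mem_center_specialUnitaryGroup_iff z).1 hz
  refine ⟨centerPhase 2 k, ?_, ?_⟩
  · have hdet : (z : Matrix (Fin 2) (Fin 2) ℂ).det = 1 := (Matrix.mem_specialUnitaryGroup_iff.mp z.2).2
    rw [hk] at hdet
    change (centerPhase 2 k • (1 : Matrix (Fin 2) (Fin 2) ℂ)).det = 1 at hdet
    rw [Matrix.det_smul, Matrix.det_one, mul_one, Fintype.card_fin] at hdet
    exact mul_self_eq_one_iff.mp (by rw [← sq]; exact hdet)
  · rw [hk]; rfl

/-- Conjugation by a twisted link: the centre factor cancels. [folklore] -/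
theorem conj_center_mul {z : SU2} (hz : z ∈ Subgroup.center SU2) (V : SU2) (M : Matrix (Fin 2) (Fin 2) ℂ) :
    su2Rep (z * V) * M * su2Rep (z * V)⁻¹ = su2Rep V * M * su2Rep V⁻¹ ∧
    su2Rep (z * V)⁻¹ * M * su2Rep (z * V) = su2Rep V⁻¹ * M * su2Rep V := by
  obtain ⟨c, hc, hzc⟩ := coe_center_su2 hz
  have hcc : c * c = 1 := by rcases hc with rfl | rfl <;> norm_num
  have hzinv : su2Rep z⁻¹ = c • (1 : Matrix (Fin 2) (Fin 2) ℂ) := by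
    rw [su2Rep_inv_eq_matrix_inv, hzc]
    refine Matrix.inv_eq_right_inv ?_
    rw [Matrix.smul_mul, Matrix.one_mul, smul_smul, hcc, one_smul]
  constructor
  · rw [mul_inv_rev, map_mul, map_mul, hzc, hzinv]
    simp only [Matrix.smul_mul, Matrix.mul_smul, Matrix.one_mul, Matrix.mul_one, smul_smul, hcc, one_smul]
  · rw [mul_inv_rev, map_mul, map_mul, hzc, hzinv]
    simp only [Matrix.smul_mul, Matrix.mul_smul, Matrix.one_mul, Matrix.mul_one, smul_smul, hcc, one_smul]

/-- One smoothing step does not see a centre twist. [folklore] -/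
theorem smoothStep_twist (k : Fin 3) {z : SU2} (hz : z ∈ Subgroup.center SU2) (U : GaugeConfig 3 L SU2)
    (m : Site 3 L → Matrix (Fin 2) (Fin 2) ℂ) (s : Site 3 L) :
    ((1 / 5 : ℂ) • (m s + ∑ i ∈ ({1, 2} : Finset (Fin 3)),
        (su2Rep ((twist k z U) (s, i)) * m ((s).shift i) * su2Rep ((twist k z U) (s, i))⁻¹ +
          su2Rep ((twist k z U) (s - Pi.single i 1, i))⁻¹ * m (s - Pi.single i 1) * su2Rep ((twist k z U) (s - Pi.single i 1, i))))) = ((1 / 5 : ℂ) • (m s + ∑ i ∈ ({1, 2} : Finset (Fin 3)),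
        (su2Rep (U (s, i)) * m ((s).shift i) * su2Rep (U (s, i))⁻¹ +
          su2Rep (U (s - Pi.single i 1, i))⁻¹ * m (s - Pi.single i 1) * su2Rep (U (s - Pi.single i 1, i))))) := by
  have h : ∀ e : Edge 3 L, su2Rep (twist k z U e) * m (e.1.shift e.2) * su2Rep (twist k z U e)⁻¹ =
      su2Rep (U e) * m (e.1.shift e.2) * su2Rep (U e)⁻¹ ∧
      su2Rep (twist k z U e)⁻¹ * m e.1 * su2Rep (twist k z U e) = su2Rep (U e)⁻¹ * m e.1 * su2Rep (U e) := by
    intro e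
    unfold twist
    split_ifs
    · exact ⟨(conj_center_mul hz (U e) _).1, (conj_center_mul hz (U e) _).2⟩
    · exact ⟨rfl, rfl⟩
  congr 2
  refine Finset.sum_congr rfl fun i _ => ?_
  rw [(h (s, i)).1, (h (s - Pi.single i 1, i)).2]

/-- The seed does not see a centre twist (`M₀(−P) = M₀(P)`). [folklore] -/
theorem seed_twist [NeZero L] (k : Fin 3) {z : SU2} (hz : z ∈ Subgroup.center SU2) (U : GaugeConfig 3 L SU2) (s : Site 3 L) :
    (((su2Rep (polyakovSite s (twist k z U) ((0 : Site 3 1), (1 : Fin 3)))).trace.re : ℂ) • ((1 / 2 : ℂ) • (su2Rep (polyakovSite s (twist k z U) ((0 : Site 3 1), (1 : Fin 3))) - su2Rep (polyakovSite s (twist k z U) ((0 : Site 3 1), (1 : Fin 3)))⁻¹))) = (((su2Rep (polyakovSite s U ((0 : Site 3 1), (1 : Fin 3)))).trace.re : ℂ) • ((1 / 2 : ℂ) • (su2Rep (polyakovSite s U ((0 : Site 3 1), (1 : Fin 3))) - su2Rep (polyakovSite s U ((0 : Site 3 1), (1 : Fin 3)))⁻¹))) := by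
  rw [polyakovSite_twist k hz U s]
  unfold twist
  split_ifs
  · obtain ⟨c, hc, hzc⟩ := coe_center_su2 hz
    have hcc : c * c = 1 := by rcases hc with rfl | rfl <;> norm_num
    have hzinv : su2Rep z⁻¹ = c • (1 : Matrix (Fin 2) (Fin 2) ℂ) := by
      rw [su2Rep_inv_eq_matrix_inv, hzc]
      refine Matrix.inv_eq_right_inv ?_
      rw [Matrix.smul_mul, Matrix.one_mul, smul_smul, hcc, one_smul]
    have hcre : ∀ w : ℂ, ((c * w).re : ℂ) = c * (w.re : ℂ) := by
      intro w; rcases hc with rfl | rfl <;> simp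
    rw [mul_inv_rev, map_mul, map_mul, hzc, hzinv, Matrix.smul_mul, Matrix.one_mul, Matrix.mul_smul, Matrix.mul_one, Matrix.trace_smul,
      smul_eq_mul, hcre, ← smul_sub, smul_comm (1 / 2 : ℂ) c, smul_smul, smul_smul, mul_comm (c * _) c, ← mul_assoc, hcc, one_mul]
    exact mul_smul _ _ _
  · rfl

/-- ★ **`B(twist_k^z U) = B(U)`.** [folklore] -/
theorem smoothedField_twist [NeZero L] (n : ℕ) (k : Fin 3) {z : SU2} (hz : z ∈ Subgroup.center SU2) (U : GaugeConfig 3 L SU2) :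
    (((fun m : Site 3 L → Matrix (Fin 2) (Fin 2) ℂ => fun s : Site 3 L =>
        (1 / 5 : ℂ) • (m s + ∑ i ∈ ({1, 2} : Finset (Fin 3)),
          (su2Rep ((twist k z U) (s, i)) * m (s.shift i) * su2Rep ((twist k z U) (s, i))⁻¹ +
            su2Rep ((twist k z U) (s - Pi.single i 1, i))⁻¹ * m (s - Pi.single i 1) * su2Rep ((twist k z U) (s - Pi.single i 1, i))))))^[n] (fun s : Site 3 L => (((su2Rep (polyakovSite s (twist k z U) ((0 : Site 3 1), (1 : Fin 3)))).trace.re : ℂ) • ((1 / 2 : ℂ) • (su2Rep (polyakovSite s (twist k z U) ((0 : Site 3 1), (1 : Fin 3))) - su2Rep (polyakovSite s (twist k z U) ((0 : Site 3 1), (1 : Fin 3)))⁻¹))))) = (((fun m : Site 3 L → Matrix (Fin 2) (Fin 2) ℂ => fun s : Site 3 L =>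
        (1 / 5 : ℂ) • (m s + ∑ i ∈ ({1, 2} : Finset (Fin 3)),
          (su2Rep (U (s, i)) * m (s.shift i) * su2Rep (U (s, i))⁻¹ +
            su2Rep (U (s - Pi.single i 1, i))⁻¹ * m (s - Pi.single i 1) * su2Rep (U (s - Pi.single i 1, i))))))^[n] (fun s : Site 3 L => (((su2Rep (polyakovSite s U ((0 : Site 3 1), (1 : Fin 3)))).trace.re : ℂ) • ((1 / 2 : ℂ) • (su2Rep (polyakovSite s U ((0 : Site 3 1), (1 : Fin 3))) - su2Rep (polyakovSite s U ((0 : Site 3 1), (1 : Fin 3)))⁻¹))))) := by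
  have hT : (fun m : Site 3 L → Matrix (Fin 2) (Fin 2) ℂ => fun s : Site 3 L =>
        (1 / 5 : ℂ) • (m s + ∑ i ∈ ({1, 2} : Finset (Fin 3)),
          (su2Rep ((twist k z U) (s, i)) * m (s.shift i) * su2Rep ((twist k z U) (s, i))⁻¹ +
            su2Rep ((twist k z U) (s - Pi.single i 1, i))⁻¹ * m (s - Pi.single i 1) * su2Rep ((twist k z U) (s - Pi.single i 1, i))))) = (fun m : Site 3 L → Matrix (Fin 2) (Fin 2) ℂ => fun s : Site 3 L =>
        (1 / 5 : ℂ) • (m s + ∑ i ∈ ({1, 2} : Finset (Fin 3)),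
          (su2Rep (U (s, i)) * m (s.shift i) * su2Rep (U (s, i))⁻¹ +
            su2Rep (U (s - Pi.single i 1, i))⁻¹ * m (s - Pi.single i 1) * su2Rep (U (s - Pi.single i 1, i))))) := by
    funext m s
    exact smoothStep_twist k hz U m s
  have hS : (fun s : Site 3 L => (((su2Rep (polyakovSite s (twist k z U) ((0 : Site 3 1), (1 : Fin 3)))).trace.re : ℂ) • ((1 / 2 : ℂ) • (su2Rep (polyakovSite s (twist k z U) ((0 : Site 3 1), (1 : Fin 3))) - su2Rep (polyakovSite s (twist k z U) ((0 : Site 3 1), (1 : Fin 3)))⁻¹)))) = (fun s : Site 3 L => (((su2Rep (polyakovSite s U ((0 : Site 3 1), (1 : Fin 3)))).trace.re : ℂ) • ((1 / 2 : ℂ) • (su2Rep (polyakovSite s U ((0 : Site 3 1), (1 : Fin 3))) - su2Rep (polyakovSite s U ((0 : Site 3 1), (1 : Fin 3)))⁻¹)))) := by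
    funext s
    exact seed_twist k hz U s
  rw [hT, hS]

end Summit.QuantumFields.YangMills.Theorems.TransportField

end
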